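import Summits.RiemannHypothesis.RiemannHypothesis.Theorems.WeilTwoPrimeDeflM80PBase
import Literature.NumberTheory.LFunctions.WeilBlockRows
import Literature.NumberTheory.LFunctions.WeilBlockRowsDCFast
import HarnessLib

/-!
# Even-sector deflated two-prime certificate M80P: rows 40–43 of the even check `D C = I`

`WeilCert.checkDCRow 0` for certificate M80P, row by row via the linear-traversal check `WeilCert.checkDCRowF` (`decide +kernel`) and `WeilCert.checkDCRow_of_F`. Pure proof file.
-/

set_option linter.dupNamespace false

noncomputable section

namespace Summit.RiemannHypothesis.RiemannHypothesis.Theorems.EvenWinsBeyondArch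

open Literature.NumberTheory.LFunctions

set_option maxHeartbeats 0 in
/-- Fast kernel check of row 40 of the even `D C = I` (certificate M80P; linear traversals). [folklore] -/
theorem checkDCRowF0_40_weilCertDeflM80P : weilCertDeflM80PBase.checkDCRowF 0 40 = true := by
  decide +kernel

/-- Row 40 of the even `D C = I` (certificate M80P), from the fast check. [folklore] -/
theorem checkDCRow0_40_weilCertDeflM80P : weilCertDeflM80PBase.checkDCRow 0 40 = true :=
  WeilCert.checkDCRow_of_F checkDCRowF0_40_weilCertDeflM80P

set_option maxHeartbeats 0 in
/-- Fast kernel check of row 41 of the even `D C = I` (certificate M80P; linear traversals). [folklore] -/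
theorem checkDCRowF0_41_weilCertDeflM80P : weilCertDeflM80PBase.checkDCRowF 0 41 = true := by
  decide +kernel

/-- Row 41 of the even `D C = I` (certificate M80P), from the fast check. [folklore] -/
theorem checkDCRow0_41_weilCertDeflM80P : weilCertDeflM80PBase.checkDCRow 0 41 = true :=
  WeilCert.checkDCRow_of_F checkDCRowF0_41_weilCertDeflM80P

set_option maxHeartbeats 0 in
/-- Fast kernel check of row 42 of the even `D C = I` (certificate M80P; linear traversals). [folklore] -/
theorem checkDCRowF0_42_weilCertDeflM80P : weilCertDeflM80PBase.checkDCRowF 0 42 = true := by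
  decide +kernel

/-- Row 42 of the even `D C = I` (certificate M80P), from the fast check. [folklore] -/
theorem checkDCRow0_42_weilCertDeflM80P : weilCertDeflM80PBase.checkDCRow 0 42 = true :=
  WeilCert.checkDCRow_of_F checkDCRowF0_42_weilCertDeflM80P

set_option maxHeartbeats 0 in
/-- Fast kernel check of row 43 of the even `D C = I` (certificate M80P; linear traversals). [folklore] -/
theorem checkDCRowF0_43_weilCertDeflM80P : weilCertDeflM80PBase.checkDCRowF 0 43 = true := by
  decide +kernel

/-- Row 43 of the even `D C = I` (certificate M80P), from the fast check. [folklore] -/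
theorem checkDCRow0_43_weilCertDeflM80P : weilCertDeflM80PBase.checkDCRow 0 43 = true :=
  WeilCert.checkDCRow_of_F checkDCRowF0_43_weilCertDeflM80P


end Summit.RiemannHypothesis.RiemannHypothesis.Theorems.EvenWinsBeyondArch
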